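import Literature.NumberTheory.Automorphic.Liu2021.Def45AsPrinted
import Literature.NumberTheory.DiophantineGeometry.AVIsogenyTateFreeHomProofs
import Literature.AlgebraicGeometry.Motives.HodgeStructureOfCMType
import HarnessLib

/-!
# [Liu 2021] Definition 4.5 (2), first bullet — consistency at RATIONAL `x` (vacuity guard of the normalisation)

Y. Liu, *Fourier–Jacobi cycles and arithmetic relative trace formula*, Camb. J. Math. **9** (2021) =
arXiv:2102.11518 [Liu2021], `FJcycle.tex` Def. 4.5 = `de:cm_data`, ll. 1936–1964; companion THEOREM file of
`Liu2021/Def45AsPrinted` (sub-object (I1) of the pub-hodgecm2 `hCMisogE` table, audit point (R2) of the team lead).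

The first bullet of Def. 4.5 (2) (l. 1950) — «for every `x ∈ M_μ`, the determinant of the action of `i_μ(x)` on the
`E`-vector space `Lie_E(A_μ)` equals `η_μ(x)`» — is typed in `Def45.CMDatum.det45` with `η_μ` DEFINED as the reflex
type norm composed with the field norm (`Def45.eta`, NOT an inverse, CM type `Φ_μ`, NOT its conjugate).  This file
checks that the chosen normalisation cannot clash with the CM-structure condition `[M_μ : ℚ] = 2 dim A_μ`
(`CMDatum.finrank_eq`) on the rational line `ℚ ⊆ M_μ`, where BOTH sides are forced:

* `Def45.apply_eta_algebraMap` — **`η_μ(q) = q^{[M_μ:ℚ]/2}`** for `q ∈ ℚ` (read in `ℂ`; `Def45.eta_algebraMap` in `E`):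
  `ι(φ(η_μ(q))) = ∏_{θ ∈ Ψ̃_μ} θ(q) = q^{|Ψ̃_μ|}` (`Def45.apply_eta_eq_finprod`, tr-prover-1's (N)) and `2 |Ψ̃_μ| = [M_μ:ℚ]`
  for the CM type `Ψ̃_μ` (`HodgeStructure.two_mul_ncard_cmType_eq_finrank`);
* `Def45.det_cotangentMap_eq_of_of_eq_algebraMap` — if `1 ⊗ f = r ∈ ℚ` in `End⁰(A)` then
  **`det(f^* | 𝔪_e/𝔪_e²) = r^{dim A}`**: clearing the denominator of `r = a/b`, `b f = [a]_A` in `End A`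
  (`End A ↪ End⁰ A`, `endAlgebra.of_injective_of_charZero`), so `b · f^* = a` on the `dim A`-dimensional cotangent
  space (`cotangentMap_zsmul`, `cotangentMap_zsmul_id_eq_smul`, `finrank_cotangent`);
* `Def45.det45_algebraMap` — **the first bullet HOLDS at every rational `x = q` for ANY pair `(A, i)` with
  `[M_μ : ℚ] = 2 dim A`**, in the exact currency of `CMDatum.det45` (every presentation `i(q) = M⁻¹ · (1 ⊗ f)`):
  `det(f^*) = (M q)^{dim A} = M^{dim A} · η_μ(q)`.  So `det45` imposes NOTHING at rational `x` beyond `finrank_eq`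
  (with the inverse normalisation `η_μ⁻¹` the two sides would be `q^{dim A}` vs `q^{-dim A}`).

Theorems only; no named facts; nothing about [Liu2021] is asserted beyond `Def45AsPrinted`.

## References
* [Liu2021] Y. Liu, arXiv:2102.11518, Def. 4.5 (ll. 1936–1964), first bullet l. 1950.
* [Shimura1998] G. Shimura, *Abelian Varieties with Complex Multiplication and Modular Functions* (1998), §8.3
  Prop. 29 (type norm), §18.5 (18.5b).
* [MumfordAV1970] D. Mumford, *Abelian Varieties* (1970), §19 Thm. 3 (`End A` is torsion-free).
-/

set_option autoImplicit false

noncomputable section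

open NumberField
open Literature.AlgebraicGeometry.Motives (CMType AbelianVariety)
open Literature.AlgebraicGeometry.Motives
open Literature.NumberTheory.ComplexMultiplication

namespace Literature.NumberTheory.Automorphic.Liu2021

namespace Def45

variable {E : Type} [Field E] [NumberField E] [IsCMField E]
variable {L : Type} [Field L] [NumberField L] [IsGalois ℚ L] (φ : E →ₐ[ℚ] L) (ι : L →+* ℂ)
variable {μ : IdeleClassGroup E →ₜ* Circle} (hμ : IdeleClassGroup.IsConjugateSymplectic E μ)

/-! ## `η_μ` on the rational line -/

section Eta

variable [IsCMField L]

/-- A constant finite product over a set: `∏ᶠ θ ∈ S, c = c ^ |S|`. [folklore] -/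
private theorem finprod_mem_const_eq_pow {α β : Type*} [CommMonoid β] (S : Set α) (hS : S.Finite) (c : β) :
    ∏ᶠ _θ ∈ S, c = c ^ S.ncard := by
  rw [finprod_mem_eq_finite_toFinset_prod _ hS, Finset.prod_const, Set.ncard_eq_toFinset_card S hS]

/-- **`η_μ(q) = q^{[M_μ:ℚ]/2}` for `q ∈ ℚ`, read in `ℂ`**: `ι(φ(η_μ(q))) = ∏_{θ ∈ Ψ̃_μ} θ(q) = q^{|Ψ̃_μ|}` and
`2 |Ψ̃_μ| = [M_μ : ℚ]` (a CM type is half of the embeddings).  The weight normalisation behind the first bullet of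
Def. 4.5 (2). [cite: Liu2021, Def. 4.5 (1) (l. 1941)] [cite: Shimura1998, §8.3 Prop. 29] -/
theorem apply_eta_algebraMap (q : ℚ) :
    ι (φ (eta φ ι hμ (algebraMap ℚ (IdeleClassGroup.muAlgValueField E μ) q))) =
      (q : ℂ) ^ (Module.finrank ℚ (IdeleClassGroup.muAlgValueField E μ) / 2) := by
  haveI := hμ.numberField_muAlgValueField
  rw [apply_eta_eq_finprod]
  set Ψ : CMType (IdeleClassGroup.muAlgValueField E μ) :=
    inducedCMType (incl φ ι hμ) (reflexCMType ι hμ.cmType φ) with hΨ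
  have hfin : Ψ.1.Finite := Set.toFinite _
  have hq : ∀ θ : IdeleClassGroup.muAlgValueField E μ →+* ℂ,
      θ (algebraMap ℚ (IdeleClassGroup.muAlgValueField E μ) q) = (q : ℂ) := fun θ => by
    rw [← eq_ratCast (θ.comp (algebraMap ℚ _)) q, RingHom.comp_apply]
  rw [finprod_mem_congr rfl fun θ _ => hq θ, finprod_mem_const_eq_pow _ hfin]
  congr 1
  have h2 := HodgeStructure.two_mul_ncard_cmType_eq_finrank Ψ
  omega

/-- **`η_μ(q) = q^{[M_μ:ℚ]/2}` in `E`** for `q ∈ ℚ` (`ι ∘ φ : E → ℂ` is injective).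
[cite: Liu2021, Def. 4.5 (1) (l. 1941)] [cite: Shimura1998, §8.3 Prop. 29] -/
theorem eta_algebraMap (q : ℚ) :
    eta φ ι hμ (algebraMap ℚ (IdeleClassGroup.muAlgValueField E μ) q) =
      algebraMap ℚ E q ^ (Module.finrank ℚ (IdeleClassGroup.muAlgValueField E μ) / 2) := by
  have hinj : Function.Injective (fun x : E => ι (φ x)) := ι.injective.comp (φ : E →+* L).injective
  apply hinj
  simp only [map_pow]
  rw [apply_eta_algebraMap, AlgHom.commutes, ← eq_ratCast (ι.comp (algebraMap ℚ L)) q, RingHom.comp_apply]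

end Eta

/-! ## The cotangent determinant of an endomorphism that is RATIONAL in `End⁰(A)` -/

section Cotangent

open CategoryTheory

variable (A : AbelianVariety E)

omit [IsCMField E] in
/-- **If `1 ⊗ f = r ∈ ℚ` in `End⁰(A) = ℚ ⊗ End A`, then `det(f^* | 𝔪_e/𝔪_e²) = r^{dim A}`**: with `r = a/b`,
`1 ⊗ (b f) = 1 ⊗ [a]_A`, so `b f = [a]_A` (`End A ↪ End⁰ A` in characteristic `0`), `b · f^* = a · id` on the
`dim A`-dimensional cotangent space, and `det f^* = (a/b)^{dim A}`.
[cite: MumfordAV1970, §19 Thm. 3] [cite: GortzWedhorn2023, proof of Prop. 27.187 (p. 888)] -/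
theorem det_cotangentMap_eq_of_of_eq_algebraMap (f : A ⟶ A) (r : ℚ)
    (h : AbelianVariety.endAlgebra.of A f = algebraMap ℚ A.endAlgebra r) :
    LinearMap.det (AbelianVariety.cotangentMap A f) = algebraMap ℚ E r ^ A.dim := by
  -- clear the denominator: `r.den • f = r.num • 𝟙 A` in `End A ↪ End⁰ A`
  have hEnd : (r.den : ℤ) • f = r.num • 𝟙 A := by
    apply AbelianVariety.endAlgebra.of_injective_of_charZero (A := A)
    have h1 : AbelianVariety.endAlgebra.of A ((r.den : ℤ) • f) =
        (r.den : ℤ) • AbelianVariety.endAlgebra.of A f := by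
      exact map_zsmul (AbelianVariety.endAlgebra.of A) _ (End.of f)
    have h2 : AbelianVariety.endAlgebra.of A (r.num • 𝟙 A) = r.num • (1 : A.endAlgebra) := by
      rw [← map_one (AbelianVariety.endAlgebra.of A)]
      exact map_zsmul (AbelianVariety.endAlgebra.of A) _ (End.of (𝟙 A))
    show AbelianVariety.endAlgebra.of A ((r.den : ℤ) • f) = AbelianVariety.endAlgebra.of A (r.num • 𝟙 A)
    rw [h1, h2, h, zsmul_eq_mul, zsmul_eq_mul, mul_one, Int.cast_natCast,
      ← map_natCast (algebraMap ℚ A.endAlgebra) r.den, ← map_mul, Rat.den_mul_eq_num, map_intCast]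
  -- on the cotangent space: `r.den • f^* = r.num • id`
  have hcot : ((r.den : ℤ) : E) • AbelianVariety.cotangentMap A f =
      ((r.num : ℤ) : E) • (LinearMap.id : AbelianVariety.Cotangent A →ₗ[E] AbelianVariety.Cotangent A) := by
    rw [Int.cast_smul_eq_zsmul, Int.cast_smul_eq_zsmul, ← AbelianVariety.cotangentMap_zsmul, hEnd,
      AbelianVariety.cotangentMap_zsmul_id_eq_smul, Int.cast_smul_eq_zsmul]
  have hden : ((r.den : ℤ) : E) ≠ 0 := by
    rw [Int.cast_natCast]; exact Nat.cast_ne_zero.2 r.den_ne_zero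
  have hf : AbelianVariety.cotangentMap A f =
      (algebraMap ℚ E r) • (LinearMap.id : AbelianVariety.Cotangent A →ₗ[E] AbelianVariety.Cotangent A) := by
    have := congr_arg (fun g => ((r.den : ℤ) : E)⁻¹ • g) hcot
    simp only [smul_smul, inv_mul_cancel₀ hden, one_smul] at this
    rw [this, eq_ratCast (algebraMap ℚ E) r, Rat.cast_def, div_eq_inv_mul, Int.cast_natCast]
  rw [hf, LinearMap.det_smul, LinearMap.det_id, mul_one, AbelianVariety.finrank_cotangent]

end Cotangent

/-! ## The first bullet at rational `x` holds for every `(A, i)` with `[M_μ : ℚ] = 2 dim A` -/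

section Det45

variable [IsCMField L]

/-- **[Liu2021, Def. 4.5 (2), first bullet] AT RATIONAL `x` IS AUTOMATIC**: for ANY abelian variety `A/E` and ANY ring
homomorphism `i : M_μ → End⁰(A)` with `[M_μ : ℚ] = 2 dim A` (the CM-structure count `CMDatum.finrank_eq`), and every
presentation `i(q) = M⁻¹ · (1 ⊗ f)` of a rational `x = q`, `det(f^* | 𝔪_e/𝔪_e²) = M^{dim A} · η_μ(q)` — the exact
currency of `CMDatum.det45`.  Both sides equal `(M q)^{dim A}`: the left by `det_cotangentMap_eq_of_of_eq_algebraMap`,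
the right by `eta_algebraMap` (`η_μ(q) = q^{[M_μ:ℚ]/2} = q^{dim A}`).  Vacuity guard (audit (R2)): the DEFINED
normalisation of `η_μ` (reflex type norm ∘ field norm, type `Φ_μ`) is the one compatible with `finrank_eq`; `det45`
adds no condition on `ℚ ⊆ M_μ`. [cite: Liu2021, Def. 4.5 (2) (l. 1950)] [cite: Shimura1998, §8.3 Prop. 29] -/
theorem det45_algebraMap (A : AbelianVariety E)
    (i : IdeleClassGroup.muAlgValueField E μ →+* A.endAlgebra)
    (hfr : Module.finrank ℚ (IdeleClassGroup.muAlgValueField E μ) = 2 * A.dim)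
    (q : ℚ) (M : ℕ) (f : CategoryTheory.End A) (hM : M ≠ 0)
    (h : i (algebraMap ℚ _ q) =
      algebraMap ℚ A.endAlgebra (M : ℚ)⁻¹ * AbelianVariety.endAlgebra.of A f) :
    LinearMap.det (AbelianVariety.cotangentMap A f) = (M : E) ^ A.dim * eta φ ι hμ (algebraMap ℚ _ q) := by
  haveI := hμ.numberField_muAlgValueField
  -- `i` is a `ℚ`-algebra map: `i(q) = q`
  have hi : i (algebraMap ℚ _ q) = algebraMap ℚ A.endAlgebra q := (i.toRatAlgHom).commutes q
  -- hence `1 ⊗ f = M q`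
  have hof : AbelianVariety.endAlgebra.of A f = algebraMap ℚ A.endAlgebra ((M : ℚ) * q) := by
    have hM' : (algebraMap ℚ A.endAlgebra (M : ℚ)) * algebraMap ℚ A.endAlgebra (M : ℚ)⁻¹ = 1 := by
      rw [← map_mul, mul_inv_cancel₀ (Nat.cast_ne_zero.2 hM), map_one]
    calc AbelianVariety.endAlgebra.of A f
        = (algebraMap ℚ A.endAlgebra (M : ℚ) * algebraMap ℚ A.endAlgebra (M : ℚ)⁻¹) *
            AbelianVariety.endAlgebra.of A f := by rw [hM', one_mul]
      _ = algebraMap ℚ A.endAlgebra (M : ℚ) * i (algebraMap ℚ _ q) := by rw [mul_assoc, ← h]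
      _ = algebraMap ℚ A.endAlgebra ((M : ℚ) * q) := by rw [hi, map_mul]
  rw [det_cotangentMap_eq_of_of_eq_algebraMap A f _ hof, eta_algebraMap, hfr, map_mul, map_natCast, mul_pow,
    Nat.mul_div_cancel_left _ (by norm_num : 0 < 2)]

/-- The same for a CM datum `D_μ` (its `finrank_eq`): the instance of `D.det45` at a rational `x` carries no
information. [cite: Liu2021, Def. 4.5 (2) (l. 1950)] -/
theorem CMDatum.det45_algebraMap {hw : IdeleClassGroup.HasWeight E μ 1} {C : Carriers E μ}
    (D : CMDatum φ ι hμ hw C) (q : ℚ) (M : ℕ) (f : CategoryTheory.End D.A) (hM : M ≠ 0)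
    (h : D.i (algebraMap ℚ _ q) =
      algebraMap ℚ D.A.endAlgebra (M : ℚ)⁻¹ * AbelianVariety.endAlgebra.of D.A f) :
    LinearMap.det (AbelianVariety.cotangentMap D.A f) = (M : E) ^ D.A.dim * eta φ ι hμ (algebraMap ℚ _ q) :=
  Def45.det45_algebraMap φ ι hμ D.A D.i D.finrank_eq q M f hM h

end Det45

end Def45

end Literature.NumberTheory.Automorphic.Liu2021

end
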